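import Mathlib
import HarnessLib
import Summits.Langlands.Langlands.Theses.NonParallelVoid
import Summits.Langlands.Langlands.Theorems.NonParallelVoidTwistedInductionParallelSymmetriseDefs
import Summits.Langlands.Langlands.Theorems.NonParallelVoidTensorSquareParallelStubOrdinaryDihedralVoid
import Summits.Langlands.Langlands.Theorems.NonParallelVoidTensorSquareParallelStubDihedralTypeOfTrace
import Summits.Langlands.Langlands.Theorems.NonParallelVoidTensorSquareParallelStubEnormousResidualPackage
import Literature.NumberTheory.GaloisRepresentations.ProjectiveType

/-!
# Line `potaut` for crux stmt-Langlands-17002 — RESHAPE r3 (lead prover-line-stmt-Langlands-17002-c1-0, 2026-08-17)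
`Summit.Langlands.Langlands.Theses.NonParallelVoid.LocallyReducibleParallel`

Route `route-Langlands-NonParallelVoid`.  The crux (rank 5, THE NEARLY ORDINARY SECTOR): for `F`
imaginary quadratic, any prime `p`, every irreducible, a.e. unramified `ρ : Γ_F → GL₂(ℚ̄_p)`, de
Rham at each `v ∣ p` (pinned Fontaine datum) with two DISTINCT `τ`-labelled Hodge–Tate weights
`{a < b}` at every label `(v, τ)`, nearly ordinary at every `v ∣ p` (`HasInvariantCompleteFlag`), all
labels have the same gap (`Parallel F p ρ`).

## Why r3 (what changed since r2, `Lines/potaut.lean` of lead 0)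

r2 had four open stubs: three POTENTIAL-AUTOMORPHY stubs concluding `∃ F' π T' ι, HLTT.IsCompatible …`
(not landable: no constructible `CuspidalAutomorphicRepData`, and their "print" inputs — ACC+ 6.1.2,
Moret-Bailly, AHTW 1.2.1 — were absent) and `stub_dictionary` (blocked on AHTW 1.2.1).  Since then the
sibling cruxes of this route LANDED exactly the machinery r2 was re-inventing:

* `Theorems.TensorSquareParallel.stub_ordinaryDihedralVoid` (p169582) with its two parts
  `exists_isAutomorphic_restrictField` (Qian 2023 Thm 1.4 at the PINNED Hodge data ⇒ `ρ|Γ_{K'}`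
  automorphic over a CM `K'`) and `false_of_isAutomorphic_of_gap_ne` (AHTW 2026 Thm 1.2.1 exact
  weights + label-wise base change + Clozel purity (PROVED) + two embeddings of `F` ⇒ two labels with
  different gaps are impossible) — this SUBSUMES r2's `stub_dictionary`, `stub_purityGap` (landed
  p165845, now unused by the composition) and the `HLTT`-shaped conclusions of r2's stubs 1–3;
* `Theorems.TensorSquareParallel.stub_dihedralType_of_trace` (p167854) and
  `stub_enormousResidualPackage` (p168313): Qian's residual package (iii)–(iv) for projectively
  DIHEDRAL `ρ̄|Γ_{F(ζ_p)}`, `p ≥ 11` split (Caraiani–Newton 6.2.2 decomposed genericity, enormousness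
  of prime-to-`p` dihedral images, the scalar element of ACC+ Rem 6.1.4 — all PROVED);
* the vocabulary `HasTwoWeights / Parallel / NonParallelPair` and the glue
  `stub_nonParallelPairOfNotParallel` (`Theorems/…TwistedInductionParallelSymmetriseDefs`, p168558).

So the honest shape of this crux TODAY is: on the route's GOOD REGIME (`11 ≤ p`, `p` split, `ρ`
crystalline above `p`, `ρ̄|Γ_{F(ζ_p)}` absolutely irreducible) a nearly ordinary `ρ` is parallel
MODULO (E) the named facts Qian 1.4 / AHTW 1.2.1 / HT base change + the local lemma "near-ordinary
⇒ Qian-ordinary at split `p`" (the SAME debt as `TensorSquareParallel.Merged.stub_externalInputs`,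
minus BLGGT/CLH) and (B) pure GROUP THEORY producing Qian's residual package for every absolutely
irreducible `ρ̄|Γ_{F(ζ_p)}` (landed for dihedral; `stub_qianPackage_of_primeToP` = dihedral ∪
`A₄/S₄/A₅` via the PROVED Serre Prop. 16; `stub_qianPackage_of_pDvd` = `PSL₂(q)`-type images, Dickson);
OFF the good regime the crux is (C1) THE OPEN CORE `stub_residuallyDegenerate` (`ρ̄|Γ_{F(ζ_p)}` not
absolutely irreducible: Eisenstein / residually induced — Skinner–Wiles defect one, Λ-adic
Berger–Klosin; open in print) and (C2) `stub_offRegimeBigImage` (big image but `p ≤ 7`, or `p`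
non-split, or `ρ` not crystalline at some `v ∣ p`: print covers the same-sign / potentially
crystalline parts modulo local lemmas not in the tree; the MIXED-SIGN flag at a non-split `v` and
`p ≤ 5` adequacy failures are open — cdisprove cycle 1 finding (b)).

Composition `LocallyReducibleParallel_of` (kernel-checked, no `sorry`): `by_cases` absolutely
irreducible over `F(ζ_p)` (else C1); `by_cases` good regime (else C2); the package from B1/B2 by
`p ∣ |proj. image|`; then `by_contra`, `stub_nonParallelPairOfNotParallel`, and the landed
`stub_ordinaryDihedralVoid` fed with (E).

Disproof used (`Cruxes/LocallyReducibleParallel/Disproof.lean`, cdisprove cycle 1, 2026-08-17T15:00Z):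
NO KILL; §1 load-bearing hypotheses (totally complex, quadratic, irreducible) are all consumed below
(quadratic + totally complex inside `false_of_isAutomorphic_of_gap_ne`, irreducibility inside Qian's
package); §2 twist-stability (landed `Negative/TwistStable`) not needed; §4 finding (a) (scalar
element automatic at split `p ≥ 7`) is the landed `…ScalarElement` helper for dihedral type and is
re-proved for all prime-to-`p` types inside B1; finding (b) (scalar element FAILS for `p = 2`,
`p = 3 ∧ F = ℚ(√-3)`, `p = 7 ∧ F = ℚ(√-7)` tetrahedral) lies in C2's sector and is recorded there.
-/

set_option linter.dupNamespace false

noncomputable section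

namespace Summit.Langlands.Langlands.Cruxes.LocallyReducibleParallel.Potaut

open scoped NumberField MatrixGroups
open IsDedekindDomain Field NumberField Filter
open Literature.NumberTheory.GaloisRepresentations Literature.NumberTheory.PAdicHodge
  Literature.NumberTheory.Automorphic
open Summit.Langlands.Langlands.Theses.NonParallelVoid
open Summit.Langlands.Langlands.Cruxes.TwistedInductionParallel.SymmetrisePdSplit
  (HasTwoWeights Parallel NonParallelPair stub_nonParallelPairOfNotParallel)

/-! ## 1. The stubs (r3: five registered; all `sorry`) -/

/-- **STUB E — the EXTERNAL INPUTS of the line, by name (literature debt; size: facts).**  The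
published theorems the good-regime branch consumes, as the tree's NAMED FACTS at the PINNED `p`-adic
Hodge data `fontainePstAdicCompletion`: A'Campo–Hevesi–Thorne–Whitmore 2026 Thm 1.2.1 (exact labelled
weights of `r_ι(π)`, `AHTW2026.hodgeTateWeights_eq`), label-wise base change of labelled weights
(Brinon–Conrad 6.3.8, `LabelledHodgeTateWeightsBaseChangeLabelwise`), and — for SOME family of local
Artin data `𝓐` (intended: local class field theory) — Qian 2023 Thm 1.4
(`Qian2022.potentialAutomorphy_ordinary 𝓐 _`) together with the LOCAL LEMMA "near-ordinary +
pinned-crystalline + labelled weights `{a<b}` at a SPLIT `p` ⇒ Qian-ordinary with regular weights at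
`v`" (Fontaine: a crystalline sub-character of a crystalline `ρ|G_{ℚ_p}` has `t_H = t_N`, so either the
flag is in the ordinary order or `D_cris` splits and the opposite flag is; not expressible for an
abstract `LocalArtinData`, whence bundled with Qian under `∃ 𝓐`).  These are EXACTLY conjuncts 3–5 of
the sibling `TensorSquareParallel.Merged.stub_externalInputs` (one discharge serves both cruxes).
Dischargeable ONLY by proving/upgrading those facts, never by this line.
[cite: Qian2022, Thm. 1.4, Def. 1.2] [cite: AHTW2026, Thm. 1.2.1] [cite: BrinonConrad2009, Prop. 6.3.8] -/
theorem stub_externalInputs :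
    AHTW2026.hodgeTateWeights_eq (fun (K : Type) (_ : Field K) (_ : NumberField K) (p : ℕ) (_ : Fact p.Prime) (v : HeightOneSpectrum (𝓞 K)) (hv : ((p : ℕ) : 𝓞 K) ∈ v.asIdeal) => fontainePstAdicCompletion v p hv) ∧ LabelledHodgeTateWeightsBaseChangeLabelwise ∧ ∃ 𝓐 : (∀ (K : Type) [Field K] [NumberField K] (v : HeightOneSpectrum (𝓞 K)), LocalArtinData (v.adicCompletion K)), Qian2022.potentialAutomorphy_ordinary 𝓐 (fun (K : Type) (_ : Field K) (_ : NumberField K) (p : ℕ) (_ : Fact p.Prime) (v : HeightOneSpectrum (𝓞 K)) (hv : ((p : ℕ) : 𝓞 K) ∈ v.asIdeal) => fontainePstAdicCompletion v p hv) ∧ (∀ (F : Type) [Field F] [NumberField F] [Algebra.IsQuadraticExtension ℚ F] (p : ℕ) [Fact p.Prime] (ρ : FramedGaloisRep F (PadicAlgCl p) 2), (∃ v w : HeightOneSpectrum (𝓞 F), v ≠ w ∧ ((p : ℕ) : 𝓞 F) ∈ v.asIdeal ∧ ((p : ℕ) : 𝓞 F) ∈ w.asIdeal) → ∀ (v : HeightOneSpectrum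 (𝓞 F)) (hv : ((p : ℕ) : 𝓞 F) ∈ v.asIdeal), (fontainePstAdicCompletion v p hv).IsCrystallineFramed (ρ.toLocal v) → (letI := (fontainePstAdicCompletion v p hv).algebra; ∀ τ : v.adicCompletion F →ₐ[ℚ_[p]] PadicAlgCl p, ∃ a b : ℤ, a < b ∧ ρ.labelledHodgeTateWeightsAt v (fontainePstAdicCompletion v p hv).algebra (fontainePstAdicCompletion v p hv).𝔅 τ.toRingHom = {a, b}) → FramedRep.HasInvariantCompleteFlag (ρ.toLocal v) → ρ.IsOrdinaryRegularAt v (𝓐 F v)) := by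
  sorry

/-- **STUB B1 — Qian's residual package for PRIME-TO-`p` projective images (group theory; size M–L,
provable now).**  `F` imaginary quadratic, `11 ≤ p` split in `F`, `ρ̄|Γ_{F(ζ_p)}` absolutely
irreducible, and the projective image of `r := ρ̄ ∘ (Γ_{F(ζ_p)} ↪ Γ_F)` (`ρ̄ = ρ.residualRep`) of
order prime to `p` (so finite and, by the PROVED Serre 1972 Prop. 16 `Serre1972.prop16`, cyclic —
excluded by irreducibility, `not_isIrreducible_of_isCyclicType` — dihedral, `𝔄₄`, `𝔖₄` or `𝔄₅`) ⇒
hypotheses (iii)–(iv) of Qian 2023 Thm 1.4 for `τ = ρ̄`: residual rep of `ρ`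
(`isResidualRepOf_residualRep_fin_two`), `ρ̄` and `r` absolutely irreducible (lattice bridge of the
landed `stub_enormousResidualPackage`), `ρ̄` decomposed generic (landed Caraiani–Newton 6.2.2,
`isDecomposedGeneric_of_projectiveImage_ne_bot`: needs exactly prime-to-`p`, non-trivial, finite),
`r(Γ_{F(ζ_p)})` enormous (dihedral: landed `isEnormous_range_of_isDihedralType`; PRIMITIVE prime-to-`p`:
`sl₂` is a simple `k[H]`-module — a 1-dimensional sub/quotient of `sl₂` would give an `H`-stable pair
of lines — and any non-scalar `h` is regular semisimple with `tr(e_{h,α}·diag(1,-1)) = 1`), and a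
scalar `ρ̄(σ)`, `σ ∉ Γ_{F(ζ_p)}` (ACC+ Rem 6.1.4: `[F(ζ_p):F] = p - 1 ≥ 10` while cyclic quotients of
`D_m, 𝔄₄, 𝔖₄, 𝔄₅` have order `≤ 3`; landed for dihedral as `exists_not_mem_scalar_of_isDihedralType`).
The dihedral case is VERBATIM the landed `Theorems.TensorSquareParallel.stub_enormousResidualPackage`.
[cite: ACCGHLNSTT2023, Def. 6.2.28, Rem. 6.1.4] [cite: CaraianiNewton2023, Lemma 6.2.2]
[cite: Serre1972, §2.5 Prop. 16] -/
theorem stub_qianPackage_of_primeToP : ∀ (F : Type) [Field F] [NumberField F] [Algebra.IsQuadraticExtension ℚ F], NumberField.IsTotallyComplex F → ∀ (p : ℕ) [Fact p.Prime] (ρ : FramedGaloisRep F (PadicAlgCl p) 2), 11 ≤ p → (∃ v w : HeightOneSpectrum (𝓞 F), v ≠ w ∧ ((p : ℕ) : 𝓞 F) ∈ v.asIdeal ∧ ((p : ℕ) : 𝓞 F) ∈ w.asIdeal) → FramedGaloisRep.IsResiduallyAbsIrreducible (ρ.restrictField (CyclotomicField p F)) → ¬ p ∣ Nat.card (projectiveImage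 (ρ.residualRep.comp (absGaloisGroupAdjoinRootsOfUnity F p).subtype)) → (ρ.IsResidualRepOf (RingHom.id _) ρ.residualRep ∧ IsAbsIrreducible ρ.residualRep ∧ IsDecomposedGeneric ρ.residualRep ∧ IsAbsIrreducible (ρ.residualRep.comp (absGaloisGroupAdjoinRootsOfUnity F p).subtype) ∧ Subgroup.IsEnormous ((absGaloisGroupAdjoinRootsOfUnity F p).map ρ.residualRep) ∧ ∃ σ : absoluteGaloisGroup F, σ ∉ absGaloisGroupAdjoinRootsOfUnity F p ∧ ∃ c : padicAlgClResidueField p, ((ρ.residualRep σ : GL (Fin 2) (padicAlgClResidueField p)) : Matrix (Fin 2) (Fin 2) (padicAlgClResidueField p)) = c • (1 : Matrix (Fin 2) (Fin 2) (padicAlgClResidueField p))) := by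
  sorry

/-- **STUB B2 — Qian's residual package for `p`-DIVISIBLE projective images (group theory + Dickson;
size L).**  As B1 but with `p ∣ |proj. image of r|` (`r = ρ̄|Γ_{F(ζ_p)}`; the image is finite — open
kernel, `ResidualGaloisRepOpenKernel` — so this is the case `PSL₂(q) ≤ Proj r(Γ_{F(ζ_p)}) ≤ PGL₂(q)`,
`q = p^k`, by Dickson's classification of the absolutely irreducible subgroups of `GL₂(𝔽̄_p)` of order
divisible by `p ≥ 5`).  Enormous: `sl₂(k)` is simple under `SL₂(𝔽_q)` (`p` odd), `diag(a,a⁻¹)`,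
`a⁴ ≠ 1`, is regular semisimple with `tr(e·diag(1,-1)) = 1`, and `H` has no quotient of order `p`
(`PSL₂(q)` simple for `q ≥ 4`, `PGL₂(q)/PSL₂(q) = C₂`); scalar element: cyclic quotients of
`PSL₂(q), PGL₂(q)` have order `≤ 2 < p - 1`; decomposed generic: Chebotarev over `ℚ` in the Galois
closure of `F̄^{ker ρ̄}(ζ_p)` applied to the conjugacy class of a `σ ∈ Γ_{F(ζ_p)}` with `ρ̄(σ)` and
`ρ̄(cσc⁻¹)` both regular semisimple (the non-regular elements of `H ⊇ SL₂(𝔽_q)` have density `< 1/2`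
for `q ≥ 11`), as in Allen–Khare–Thorne for `SL₂(𝔽_p)`-images.  If Dickson for `GL₂(𝔽̄_p)` is not in
the tree the worker takes it as a LEADING named-fact hypothesis (stub-misstated with that antecedent).
[cite: ACCGHLNSTT2023, Def. 4.3.1, Def. 6.2.28, §7.1] [cite: AllenKhareThorne2021, §2 (decomposed genericity for SL₂(𝔽_p) images)]
[cite: Dickson1901, §260 (subgroups of PSL₂(q))] -/
theorem stub_qianPackage_of_pDvd : ∀ (F : Type) [Field F] [NumberField F] [Algebra.IsQuadraticExtension ℚ F], NumberField.IsTotallyComplex F → ∀ (p : ℕ) [Fact p.Prime] (ρ : FramedGaloisRep F (PadicAlgCl p) 2), 11 ≤ p → (∃ v w : HeightOneSpectrum (𝓞 F), v ≠ w ∧ ((p : ℕ) : 𝓞 F) ∈ v.asIdeal ∧ ((p : ℕ) : 𝓞 F) ∈ w.asIdeal) → FramedGaloisRep.IsResiduallyAbsIrreducible (ρ.restrictField (CyclotomicField p F)) → p ∣ Nat.card (projectiveImage (ρ.residualRep.comp (absGaloisGroupAdjoinRootsOfUnity F p).subtype)) → (ρ.IsResidualRepOf (RingHom.id _) ρ.residualRep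 ∧ IsAbsIrreducible ρ.residualRep ∧ IsDecomposedGeneric ρ.residualRep ∧ IsAbsIrreducible (ρ.residualRep.comp (absGaloisGroupAdjoinRootsOfUnity F p).subtype) ∧ Subgroup.IsEnormous ((absGaloisGroupAdjoinRootsOfUnity F p).map ρ.residualRep) ∧ ∃ σ : absoluteGaloisGroup F, σ ∉ absGaloisGroupAdjoinRootsOfUnity F p ∧ ∃ c : padicAlgClResidueField p, ((ρ.residualRep σ : GL (Fin 2) (padicAlgClResidueField p)) : Matrix (Fin 2) (Fin 2) (padicAlgClResidueField p)) = c • (1 : Matrix (Fin 2) (Fin 2) (padicAlgClResidueField p))) := by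
  sorry

/-- **STUB C1 — THE OPEN CORE: residually degenerate nearly ordinary `ρ` are parallel (open problem).**
`F` imaginary quadratic, any `p`, `ρ` as in the crux (irreducible, a.e. unramified, `HasTwoWeights`,
an invariant line at every `v ∣ p`) with `ρ̄|Γ_{F(ζ_p)}` NOT absolutely irreducible — `ρ̄` reducible
(`ρ̄^{ss} = χ̄₁ ⊕ χ̄₂`, the Eisenstein case) or `ρ̄` irreducible but induced from the quadratic
subextension of `F(ζ_p)/F` — ⇒ `Parallel F p ρ`.  No theorem in print: Skinner–Wiles' residually
reducible ordinary lifting needs a totally real base (defect `l₀ = 0`; over `F` Hida's nearly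
ordinary Hecke algebra is `Λ`-torsion); Thorne 2015 / Allen–Newton–Thorne 2020 are polarised only;
Berger–Klosin's `R^{red} = T^{Eis}` method over imaginary quadratic `F` is proved in parallel weight
2 with `p` split and a unique residual extension — its `Λ`-adic (two-variable Katz `L`-function)
upgrade is what this stub needs (crux idea `lambda-adic-berger-klosin`).  On the genuinely CM
sub-sector (`ρ = Ind χ`, `L = F·K₀` biquadratic CM) it is TRUE on paper by Weil/Serre type-`A₀`
(Disproof §3), but CFT for that is not in the tree.  The conclusion is asked in the WEAKEST useful
form (`Parallel`, not automorphy).  Why it might fail as typed: only with Fontaine–Mazur; the honest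
risk is that it stays open.
[cite: SkinnerWiles1999, Introduction and §4] [cite: BergerKlosin2011, Thm. 1.1] [cite: BergerKlosin2013, Thm. 1.1]
[cite: CalegariMazur2008, Conj. 1.3] [cite: AllenNewtonThorne2020, Thm. 1.1 (polarised)] -/
theorem stub_residuallyDegenerate : ∀ (F : Type) [Field F] [NumberField F] [Algebra.IsQuadraticExtension ℚ F], NumberField.IsTotallyComplex F → ∀ (p : ℕ) [Fact p.Prime] (ρ : FramedGaloisRep F (PadicAlgCl p) 2), ρ.toGaloisRep.IsIrreducible → (∀ᶠ v : HeightOneSpectrum (𝓞 F) in Filter.cofinite, ρ.IsUnramifiedAt v) → HasTwoWeights F p ρ → (∀ v : HeightOneSpectrum (𝓞 F), ((p : ℕ) : 𝓞 F) ∈ v.asIdeal → FramedRep.HasInvariantCompleteFlag (ρ.toLocal v)) → ¬ FramedGaloisRep.IsResiduallyAbsIrreducible (ρ.restrictField (CyclotomicField p F)) → Parallel F p ρ := by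
  sorry

/-- **STUB C2 — big residual image OFF the good regime (partly in print modulo local lemmas, partly
open; size XL).**  `ρ` as in the crux with an invariant line at every `v ∣ p`, `ρ̄|Γ_{F(ζ_p)}`
absolutely irreducible, but NOT (`11 ≤ p` ∧ `p` split ∧ `ρ` crystalline at every `v ∣ p`) ⇒
`Parallel F p ρ`.  Sub-sectors and their status: (i) `p` split, `ρ` de Rham but not crystalline at
some `v` — Qian 1.4 allows potentially semistable `r`, missing is only the local lemma
"near-ordinary + de Rham ⇒ Qian-ordinary at split `p`" (Bloch–Kato `H¹_g(ℚ_p(r)·μ) = 0`, `r ≤ -1`);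
(ii) `p` inert/ramified with the SAME sign of the flag at both labels of the unique `v` — print
(Qian has no splitting hypothesis) modulo the analogous local lemma; (iii) `p` inert/ramified with
MIXED signs (`HT(ψ₁/ψ₂) = (+g₁, -g₂)`): `ρ` is ordinary in NO flag, no Hida-theoretic engine —
OPEN; (iv) `p ∈ {2,3,5,7}`: the package lemmas need `[F(ζ_p):F] ≥ 10` and adequacy; cdisprove
finding (b): the scalar-element hypothesis of every printed CM-field ordinary lifting theorem FAILS
over `F` and all `F'/F` for `p = 2`, for `p = 3, F = ℚ(√-3)`, and for `p = 7, F = ℚ(√-7)` with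
tetrahedral `ρ̄` — OPEN there.  Why it might fail as typed: only with Fontaine–Mazur.
[cite: Qian2022, Thm. 1.4] [cite: ACCGHLNSTT2023, Thm. 6.1.2, Rem. 6.1.3–6.1.4] [cite: MiagkovThorne2023, Thm. 1.3]
[cite: CalegariMazur2008, §2.4] [cite: BlochKato1990, Prop. 3.8, Ex. 3.9] -/
theorem stub_offRegimeBigImage : ∀ (F : Type) [Field F] [NumberField F] [Algebra.IsQuadraticExtension ℚ F], NumberField.IsTotallyComplex F → ∀ (p : ℕ) [Fact p.Prime] (ρ : FramedGaloisRep F (PadicAlgCl p) 2), ρ.toGaloisRep.IsIrreducible → (∀ᶠ v : HeightOneSpectrum (𝓞 F) in Filter.cofinite, ρ.IsUnramifiedAt v) → HasTwoWeights F p ρ → (∀ v : HeightOneSpectrum (𝓞 F), ((p : ℕ) : 𝓞 F) ∈ v.asIdeal → FramedRep.HasInvariantCompleteFlag (ρ.toLocal v)) → FramedGaloisRep.IsResiduallyAbsIrreducible (ρ.restrictField (CyclotomicField p F)) → ¬ (11 ≤ p ∧ (∃ v w : HeightOneSpectrum (𝓞 F), v ≠ w ∧ ((p : ℕ) : 𝓞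 F) ∈ v.asIdeal ∧ ((p : ℕ) : 𝓞 F) ∈ w.asIdeal) ∧ (∀ (v : HeightOneSpectrum (𝓞 F)) (hv : ((p : ℕ) : 𝓞 F) ∈ v.asIdeal), (fontainePstAdicCompletion v p hv).IsCrystallineFramed (ρ.toLocal v))) → Parallel F p ρ := by
  sorry

/-! ## 2. The stub statements as named propositions (literally their types) -/

namespace _Goal

/-- The statement of `stub_externalInputs` (literally its type). [folklore] -/
def stub_externalInputs : Prop :=
  type_of% @Summit.Langlands.Langlands.Cruxes.LocallyReducibleParallel.Potaut.stub_externalInputs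

/-- The statement of `stub_qianPackage_of_primeToP` (literally its type). [folklore] -/
def stub_qianPackage_of_primeToP : Prop :=
  type_of% @Summit.Langlands.Langlands.Cruxes.LocallyReducibleParallel.Potaut.stub_qianPackage_of_primeToP

/-- The statement of `stub_qianPackage_of_pDvd` (literally its type). [folklore] -/
def stub_qianPackage_of_pDvd : Prop :=
  type_of% @Summit.Langlands.Langlands.Cruxes.LocallyReducibleParallel.Potaut.stub_qianPackage_of_pDvd

/-- The statement of `stub_residuallyDegenerate` (literally its type). [folklore] -/
def stub_residuallyDegenerate : Prop :=
  type_of% @Summit.Langlands.Langlands.Cruxes.LocallyReducibleParallel.Potaut.stub_residuallyDegenerate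

/-- The statement of `stub_offRegimeBigImage` (literally its type). [folklore] -/
def stub_offRegimeBigImage : Prop :=
  type_of% @Summit.Langlands.Langlands.Cruxes.LocallyReducibleParallel.Potaut.stub_offRegimeBigImage

end _Goal

/-! ## 3. The composition (kernel-checked, no `sorry`) -/

/-- **`LocallyReducibleParallel` from the five r3 stubs.**  `by_cases` on absolute irreducibility of
`ρ̄|Γ_{F(ζ_p)}` (else the open core C1) and on the good regime `11 ≤ p ∧ split ∧ crystalline` (else
C2); on the good regime Qian's residual package comes from B1/B2 (`by_cases p ∣ |proj. image|`), the
failure of `Parallel` gives two labels with different gaps (landed glue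
`stub_nonParallelPairOfNotParallel`), and the LANDED sibling theorem
`Theorems.TensorSquareParallel.stub_ordinaryDihedralVoid` — Qian 1.4 at the pinned data, AHTW exact
weights, HT base change (all from E), Clozel purity (proved) — yields `False`.  Hypotheses are, by
name, the statements of the five stubs; the conclusion is the route decl. [folklore] -/
theorem LocallyReducibleParallel_of (hE : _Goal.stub_externalInputs)
    (hB1 : _Goal.stub_qianPackage_of_primeToP) (hB2 : _Goal.stub_qianPackage_of_pDvd)
    (hC1 : _Goal.stub_residuallyDegenerate) (hC2 : _Goal.stub_offRegimeBigImage) :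
    LocallyReducibleParallel := by
  unfold _Goal.stub_externalInputs at hE
  unfold _Goal.stub_qianPackage_of_primeToP at hB1
  unfold _Goal.stub_qianPackage_of_pDvd at hB2
  unfold _Goal.stub_residuallyDegenerate at hC1
  unfold _Goal.stub_offRegimeBigImage at hC2
  intro F _ _ _ hF p _ ρ hirr hunr hHT hflag
  -- the residually degenerate sector: the open core
  by_cases hIrr : FramedGaloisRep.IsResiduallyAbsIrreducible (ρ.restrictField (CyclotomicField p F))
  swap
  · exact hC1 F hF p ρ hirr hunr hHT hflag hIrr
  -- big image off the good regime
  by_cases hG : (11 ≤ p ∧ (∃ v w : HeightOneSpectrum (𝓞 F), v ≠ w ∧ ((p : ℕ) : 𝓞 F) ∈ v.asIdeal ∧ ((p : ℕ) : 𝓞 F) ∈ w.asIdeal) ∧ (∀ (v : HeightOneSpectrum (𝓞 F)) (hv : ((p : ℕ) : 𝓞 F) ∈ v.asIdeal), (fontainePstAdicCompletion v p hv).IsCrystallineFramed (ρ.toLocal v)))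
  swap
  · exact hC2 F hF p ρ hirr hunr hHT hflag hIrr hG
  -- the good regime: Qian's package (B1/B2), then the landed sibling composition fed with E
  obtain ⟨hp, hsplit, hcrys⟩ := hG
  obtain ⟨hAHTW, hBC, 𝓐, hQ, hOrd⟩ := hE
  have hpkg : ρ.IsResidualRepOf (RingHom.id _) ρ.residualRep ∧ IsAbsIrreducible ρ.residualRep ∧ IsDecomposedGeneric ρ.residualRep ∧ IsAbsIrreducible (ρ.residualRep.comp (absGaloisGroupAdjoinRootsOfUnity F p).subtype) ∧ Subgroup.IsEnormous ((absGaloisGroupAdjoinRootsOfUnity F p).map ρ.residualRep) ∧ ∃ σ : absoluteGaloisGroup F, σ ∉ absGaloisGroupAdjoinRootsOfUnity F p ∧ ∃ c : padicAlgClResidueField p, ((ρ.residualRep σ : GL (Fin 2) (padicAlgClResidueField p)) : Matrix (Fin 2) (Fin 2) (padicAlgClResidueField p)) = c • (1 : Matrix (Fin 2) (Fin 2) (padicAlgClResidueField p)) := by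
    by_cases hdvd : p ∣ Nat.card (projectiveImage (ρ.residualRep.comp (absGaloisGroupAdjoinRootsOfUnity F p).subtype))
    · exact hB2 F hF p ρ hp hsplit hIrr hdvd
    · exact hB1 F hF p ρ hp hsplit hIrr hdvd
  by_contra hnp
  have hNP : NonParallelPair F p ρ := stub_nonParallelPairOfNotParallel F p ρ hHT hnp
  exact Summit.Langlands.Langlands.Theorems.TensorSquareParallel.stub_ordinaryDihedralVoid 𝓐 hQ hOrd
    hAHTW hBC F hF p ρ hsplit hunr hHT hcrys hflag hpkg hNP

/-- By-name sanity check: the five stubs feed the composition as they stand. -/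
example : LocallyReducibleParallel :=
  LocallyReducibleParallel_of stub_externalInputs stub_qianPackage_of_primeToP stub_qianPackage_of_pDvd
    stub_residuallyDegenerate stub_offRegimeBigImage

end Summit.Langlands.Langlands.Cruxes.LocallyReducibleParallel.Potaut

end
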